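import Literature.AlgebraicGeometry.HodgeTheory.DivisorClassesFiniteEtaleBaseChange
import Literature.AlgebraicGeometry.FundamentalGroup.RiemannExistenceSmoothAffineCurves
import HarnessLib

/-!
# The finite étale cover of a smooth complex curve attached to a finite-index subgroup of `π₁` — hypothesis-free

Family `hodge`, layer `Literature/AlgebraicGeometry/HodgeTheory`. PROOF FILE (theorems only; no
definition, no named fact — D-0026). The tree's
`exists_finiteEtale_of_finiteIndex_of_riemannExistence` (`DivisorClassesFiniteEtaleBaseChange.lean`)
produces, for a smooth irreducible quasi-projective `S`, `s ∈ S(ℂ)` and a finite-index subgroup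
`H ≤ π₁(S(ℂ), s)`, a FINITE ÉTALE `g : S' ⟶ S` with `S'(ℂ)` path connected, a point `s'` over `s`,
and all loops at `s'` mapping into `H` — GRANTED the named fact
`FundamentalGroup.riemannExistence_finiteCovering` (SGA1 XII Thm. 5.1 for all quasi-projective `S`).
Over a smooth CURVE Riemann's existence theorem is a THEOREM of the tree
(`FundamentalGroup.riemannExistence_smoothCurve`: `X` separated, smooth of relative dimension `1`),
so the same construction is unconditional there:

* `exists_finiteEtale_of_finiteIndex_smoothCurve` — for `S` separated, smooth of relative dimension
  `1` over `ℂ` and irreducible, `s ∈ S(ℂ)`, `H ≤ π₁(S(ℂ), s)` of finite index: a finite étale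
  `g : S' ⟶ S`, `S'(ℂ)` path connected, `s'` over `s`, every loop at `s'` maps by `g(ℂ)` into `H`
  (the covering of the connected manifold `S(ℂ)` attached to the normal core of `H`, Hatcher
  Prop. 1.36 / 1.32, `UniversalCover.exists_covering_of_normal`, is algebraic by Riemann existence).

This is the input "Riemann's existence theorem FOR SMOOTH CURVES" of the finite-monodromy
trivialisation over curves (Voisin 2007, §3, proof of Prop. 0.7; the KummerEndgame of route
`HodgeConjecture/RigidUnwinding`). The proof is that of the quasi-projective template with the fact
replaced by the theorem.

## References

* [SGA1] A. Grothendieck, M. Raynaud, SGA 1, Exp. XII Thm. 5.1 (p. 333), Prop. 2.4.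
* [HatcherAT2002] A. Hatcher, Algebraic Topology, §1.3 Prop. 1.32, Prop. 1.36.
* [Forster1981] O. Forster, Lectures on Riemann Surfaces, §8 Thm. 8.4.
* [Voisin2007HodgeLoci] C. Voisin, Hodge loci and absolute Hodge classes, Compositio Math. 143
  (2007), §3, proof of Prop. 0.7.
-/

noncomputable section

open CategoryTheory AlgebraicGeometry
open _root_.Topology
open Literature.AlgebraicTopology.SingularHomology
open Literature.Topology.CoveringSpaces

namespace Literature.AlgebraicGeometry.HodgeTheory

open Literature.AlgebraicGeometry.Motives

/-- **Riemann existence, finite-index form over a smooth complex curve — unconditionally.** For a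
separated, irreducible `ℂ`-scheme `S` smooth of relative dimension `1`, `s ∈ S(ℂ)` and a finite-index
subgroup `H ≤ π₁(S(ℂ), s)` (on the subspace `univ ⊆ S(ℂ)`, as the tree's transport), there are a
FINITE ÉTALE `g : S' ⟶ S` with `S'(ℂ)` path connected, a point `s'` over `s`, and every loop at `s'`
maps by `g(ℂ)` into `H`: the covering of the connected manifold `S(ℂ)` attached to the normal core of
`H` (Hatcher Prop. 1.36 / 1.32, the tree's `UniversalCover.exists_covering_of_normal`) is `S'(ℂ)`
over `S(ℂ)` by the tree's theorem `FundamentalGroup.riemannExistence_smoothCurve` (SGA1 XII Thm. 5.1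
for smooth curves). Same proof as `exists_finiteEtale_of_finiteIndex_of_riemannExistence`, with the
named fact `riemannExistence_finiteCovering` replaced by that theorem.
[cite: SGA1, Exp. XII Thm. 5.1 (p. 333)] [cite: HatcherAT2002, §1.3 Prop. 1.36 and Prop. 1.32]
[cite: Forster1981, §8 Thm. 8.4] -/
theorem exists_finiteEtale_of_finiteIndex_smoothCurve (S : SchemeOver ℂ) [IsSeparated S.hom]
    [SmoothOfRelativeDimension 1 S.hom] [IrreducibleSpace S.left] (s : ComplexPoints S)
    (H : Subgroup (FundamentalGroup (Set.univ : Set (ComplexPoints S)) ⟨s, Set.mem_univ s⟩))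
    [H.FiniteIndex] :
    ∃ (S' : SchemeOver ℂ) (g : S' ⟶ S) (s' : ComplexPoints S') (hs : AlgPoints.map g s' = s),
      IsFinite g.left ∧ Etale g.left ∧ PathConnectedSpace (ComplexPoints S') ∧
      ∀ γ' : Path (⟨s', Set.mem_univ s'⟩ : (Set.univ : Set (ComplexPoints S'))) ⟨s', Set.mem_univ s'⟩,
        FundamentalGroup.fromPath
          (⟦(γ'.map ((((AlgPoints.continuous_map g).comp continuous_subtype_val)).subtype_mk
              fun _ ↦ Set.mem_univ _)).cast (Subtype.ext hs.symm) (Subtype.ext hs.symm)⟧) ∈ H := by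
  -- adapted from `exists_finiteEtale_of_finiteIndex_of_riemannExistence` (same file family)
  -- (i) `S(ℂ)` is a connected topological manifold: path connected, strongly locally contractible
  haveI : Smooth S.hom := SmoothOfRelativeDimension.smooth 1 S.hom
  haveI : LocallyOfFiniteType S.hom := inferInstance
  letI := Motives.ComplexPoints.chartedSpace S 1
  haveI : StronglyLocallyContractibleSpace (ComplexPoints S) :=
    Literature.AlgebraicTopology.Homotopy.stronglyLocallyContractibleSpace_of_chartedSpace_normedSpace
      (EuclideanSpace ℝ (Fin (2 * 1))) _
  haveI : ConnectedSpace (ComplexPoints S) := connectedSpace_complexPoints_of_irreducibleSpace S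
  haveI : PathConnectedSpace (ComplexPoints S) :=
    pathConnectedSpace_complexPoints_of_smoothOfRelativeDimension S 1
  haveI : StronglyLocallyContractibleSpace (Set.univ : Set (ComplexPoints S)) :=
    isOpen_univ.stronglyLocallyContractibleSpace
  haveI : PathConnectedSpace (Set.univ : Set (ComplexPoints S)) :=
    isPathConnected_iff_pathConnectedSpace.mp isPathConnected_univ
  -- (ii) the covering attached to the normal core `N ⊴ π₁(S(ℂ), s)` of `H` (Hatcher 1.36, 1.32)
  obtain ⟨T, _, q, hqc, t, ht, hcov, hTpc, hfin, hloop⟩ :=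
    UniversalCover.exists_covering_of_normal (X := (Set.univ : Set (ComplexPoints S)))
      (x₀ := ⟨s, Set.mem_univ s⟩) H.normalCore
  haveI := hTpc
  let φ := Homeomorph.Set.univ (ComplexPoints S)
  have hcov' : IsCoveringMap (φ ∘ q) := hcov.homeomorph_comp φ
  have hfin' : ∀ x, ((φ ∘ q) ⁻¹' {x}).Finite := fun x ↦ by
    refine (hfin (φ.symm x)).subset fun y hy ↦ ?_
    simp only [Set.mem_preimage, Set.mem_singleton_iff, Function.comp_apply] at hy ⊢
    rw [← hy, Homeomorph.symm_apply_apply]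
  -- (iii) Riemann existence FOR SMOOTH CURVES (a theorem): `T = S'(ℂ)` over `S(ℂ)`
  obtain ⟨S', g, Φ, hgfin, hget, hΦ⟩ :=
    FundamentalGroup.riemannExistence_smoothCurve S (φ ∘ q) hcov' hfin'
  -- the base point `s'` matching `t`
  have hs : AlgPoints.map g (Φ.symm t) = s := by
    rw [← hΦ (Φ.symm t), Φ.apply_symm_apply, Function.comp_apply, ht]
    rfl
  haveI : PathConnectedSpace (ComplexPoints S') :=
    Φ.symm.surjective.pathConnectedSpace Φ.symm.continuous
  refine ⟨S', g, Φ.symm t, hs, hgfin, hget, inferInstance, fun γ' ↦ ?_⟩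
  -- the loop clause: `g(ℂ) ∘ γ'` is `q ∘ δ` for the loop `δ = Φ ∘ γ'` at `t`
  let δ : Path t t :=
    (γ'.map (Φ.continuous.comp continuous_subtype_val)).cast (Φ.apply_symm_apply t).symm
      (Φ.apply_symm_apply t).symm
  have hpath :
      ((γ'.map ((((AlgPoints.continuous_map g).comp continuous_subtype_val)).subtype_mk
          fun _ ↦ Set.mem_univ _)).cast (Subtype.ext hs.symm) (Subtype.ext hs.symm) :
        Path (⟨s, Set.mem_univ s⟩ : (Set.univ : Set (ComplexPoints S))) ⟨s, Set.mem_univ s⟩) =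
      (δ.map hqc).cast ht.symm ht.symm := by
    apply Path.ext
    funext u
    apply Subtype.ext
    change AlgPoints.map g (γ' u).1 = (φ ∘ q) (Φ (γ' u).1)
    exact (hΦ _).symm
  rw [hpath]
  exact H.normalCore_le (hloop δ)

end Literature.AlgebraicGeometry.HodgeTheory

end
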